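import Summits.Langlands.Langlands.Theses.SqrtFiveQuarticCovers
import Literature.NumberTheory.GaloisRepresentations.CartanNormalizerCriterionGL2Fp
import Literature.NumberTheory.GaloisRepresentations.CyclotomicDeterminantImageProofs

/-!
# Sketch — crux-ideate stmt-Langlands-17834 (ReductionToRefinedLocus), ideator 1, round 1

First lemmas of the two idea cards, stated over existing declarations (sorried; they only have to
elaborate), plus one PROVED micro-lemma (the golden-ratio identity behind the cyclotomic
index-two stub) and `#check`s of the tree theorems the cards lean on.
-/

namespace Summit.Langlands.Langlands.Cruxes.ReductionToRefinedLocus.IdeaSketch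

open scoped Matrix MatrixGroups
open Literature.NumberTheory.GaloisRepresentations

instance instFactPrimeFive : Fact (Nat.Prime 5) := ⟨by norm_num⟩

/-! ## Card `index-two-clifford` — first lemma: the dihedral normal form (census-free)

`H` = the determinant-one part of the image (= `ρ̄(G_{K(ζ₅)})`), `c` = the image of a complex
conjugation (involution, `det = -1`, normalises `H`), `hred` = a common eigenvector of `H` after a
base change (the literal output of
`exists_eigenvector_of_det_eq_one_of_not_isAbsolutelyIrreducible_restrictField`). Conclusion: the
coset union `H ∪ cH` (which is all of `ρ̄(G_K)` once `det ρ̄ ⊆ {±1}`) is conjugate into the Borel,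
into `H8 = ⟨diag(2,3), antidiag(1,1)⟩` or into `H12 = ⟨(3 1;3 3), diag(1,4)⟩`. -/
theorem dihedralNormalForm
    (H : Subgroup (GL (Fin 2) (ZMod 5))) (c : GL (Fin 2) (ZMod 5))
    (hcc : c * c = 1) (hcdet : Matrix.GeneralLinearGroup.det c = -1)
    (hH : ∀ h ∈ H, Matrix.GeneralLinearGroup.det h = 1)
    (hnorm : ∀ h ∈ H, c * h * c⁻¹ ∈ H)
    (hred : ∃ (B : Type) (_ : Field B) (f : ZMod 5 →+* B) (v : Fin 2 → B), v ≠ 0 ∧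
      ∀ h ∈ H, ∃ a : B, ((h : Matrix (Fin 2) (Fin 2) (ZMod 5)).map f) *ᵥ v = a • v) :
    ∃ x : GL (Fin 2) (ZMod 5),
      (∀ g : GL (Fin 2) (ZMod 5), (g ∈ H ∨ c⁻¹ * g ∈ H) →
        ((x * g * x⁻¹ : GL (Fin 2) (ZMod 5)) : Matrix (Fin 2) (Fin 2) (ZMod 5)) 1 0 = 0) ∨
      (∀ g : GL (Fin 2) (ZMod 5), (g ∈ H ∨ c⁻¹ * g ∈ H) → x * g * x⁻¹ ∈
        Subgroup.closure ({(⟨!![2, 0; 0, 3], !![3, 0; 0, 2], by decide, by decide⟩ : GL (Fin 2) (ZMod 5)),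
          (⟨!![0, 1; 1, 0], !![0, 1; 1, 0], by decide, by decide⟩ : GL (Fin 2) (ZMod 5))} :
          Set (GL (Fin 2) (ZMod 5)))) ∨
      (∀ g : GL (Fin 2) (ZMod 5), (g ∈ H ∨ c⁻¹ * g ∈ H) → x * g * x⁻¹ ∈
        Subgroup.closure ({(⟨!![3, 1; 3, 3], !![3, 4; 2, 3], by decide, by decide⟩ : GL (Fin 2) (ZMod 5)),
          (⟨!![1, 0; 0, 4], !![1, 0; 0, 4], by decide, by decide⟩ : GL (Fin 2) (ZMod 5))} :
          Set (GL (Fin 2) (ZMod 5)))) := by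
  sorry

/-! ## Both cards — the re-cut Galois-side interface at `5` (eigenvector form, not span form)

Non-modular `E` over a totally real `K` ⇒ some framing `ρ̄` of `E[5]` has an involution of
determinant `-1` in its image and a common eigenvector, after a base change, of all its
determinant-one elements. Chain (all in tree but the FLS fact): weak→strong non-modularity
(`not_isAutomorphicOfWeightZero_of_not_isModularEllipticCurve`), `FLS2015_theorems3_4.not_modPImageAbsIrreducible`
at `p = 5`, unfold `ModPImageAbsIrreducibleOverCyclotomic`, then
`exists_eigenvector_of_det_eq_one_of_not_isAbsolutelyIrreducible_restrictField` and
`exists_mul_self_eq_one_and_det_eq_neg_one_of_det_eq` (with `det = χ̄₅` from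
`WeierstrassCurve.det_eq_modPCyclotomicCharacter_of_isTorsionGaloisRep_holds`, a real embedding from
`FLS2015.exists_realEmbedding`). -/
theorem fiveEigenOdd :
    ∀ (K : Type) [Field K] [NumberField K], NumberField.IsTotallyReal K →
      ∀ E : WeierstrassCurve (NumberField.RingOfIntegers K), E.Δ ≠ 0 →
      ¬ ((E.baseChange K).HasCM ∨ ∃ (hF : Literature.NumberTheory.Automorphic.isCompact_glFiniteIntegralLevel 2 K)
          (π : Literature.NumberTheory.Automorphic.CuspidalAutomorphicRepData 2 K hF), π.1.HasWeightZero ∧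
          ∀ᶠ w : IsDedekindDomain.HeightOneSpectrum (NumberField.RingOfIntegers K) in Filter.cofinite,
            ∃ α : Multiset ℂ, π.1.HasSatakeParamAt w α ∧
              ((Real.sqrt w.residueCard : ℝ) : ℂ) * α.sum = (Literature.NumberTheory.Automorphic.frobTraceAt E w : ℂ)) →
      ∃ ρ : Literature.NumberTheory.GaloisRepresentations.FramedGaloisRep K (ZMod 5) 2,
        (∃ e : (E.baseChange K).geomTorsion ((5 : ℕ) : ℤ) ≃+ (Fin 2 → ZMod 5),
          ∀ (σ : Field.absoluteGaloisGroup K) (P : (E.baseChange K).geomTorsion ((5 : ℕ) : ℤ)),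
            e (σ • P) = ((ρ σ : GL (Fin 2) (ZMod 5)) : Matrix (Fin 2) (Fin 2) (ZMod 5)) *ᵥ (e P)) ∧
        (∃ σ₀ : Field.absoluteGaloisGroup K, ρ σ₀ * ρ σ₀ = 1 ∧ Matrix.GeneralLinearGroup.det (ρ σ₀) = -1) ∧
        (∃ (B : Type) (_ : Field B) (f : ZMod 5 →+* B) (v : Fin 2 → B), v ≠ 0 ∧
          ∀ σ : Field.absoluteGaloisGroup K, Matrix.GeneralLinearGroup.det (ρ σ) = 1 →
            ∃ a : B, (((ρ σ : GL (Fin 2) (ZMod 5)) : Matrix (Fin 2) (Fin 2) (ZMod 5)).map f) *ᵥ v = a • v) := by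
  sorry

/-! ## Card `cartan-normaliser-reuse` — first lemma: the census in the (det ±1, odd, hred) form,
to be discharged by `CaraianiNewton.exists_le_normalizer_cartan` and its exported steps. -/
theorem cartanCosetCensus :
    ∀ G : Subgroup (GL (Fin 2) (ZMod 5)),
      (∀ g ∈ G, Matrix.GeneralLinearGroup.det g = 1 ∨ Matrix.GeneralLinearGroup.det g = -1) →
      (∃ c ∈ G, c * c = 1 ∧ Matrix.GeneralLinearGroup.det c = -1) →
      (∃ (B : Type) (_ : Field B) (f : ZMod 5 →+* B) (v : Fin 2 → B), v ≠ 0 ∧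
        ∀ g ∈ G, Matrix.GeneralLinearGroup.det g = 1 →
          ∃ a : B, ((g : Matrix (Fin 2) (Fin 2) (ZMod 5)).map f) *ᵥ v = a • v) →
      ∃ x : GL (Fin 2) (ZMod 5),
        (∀ g ∈ G, ((x * g * x⁻¹ : GL (Fin 2) (ZMod 5)) : Matrix (Fin 2) (Fin 2) (ZMod 5)) 1 0 = 0) ∨
        (∀ g ∈ G, x * g * x⁻¹ ∈
          Subgroup.closure ({(⟨!![2, 0; 0, 3], !![3, 0; 0, 2], by decide, by decide⟩ : GL (Fin 2) (ZMod 5)),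
            (⟨!![0, 1; 1, 0], !![0, 1; 1, 0], by decide, by decide⟩ : GL (Fin 2) (ZMod 5))} :
            Set (GL (Fin 2) (ZMod 5)))) ∨
        (∀ g ∈ G, x * g * x⁻¹ ∈
          Subgroup.closure ({(⟨!![3, 1; 3, 3], !![3, 4; 2, 3], by decide, by decide⟩ : GL (Fin 2) (ZMod 5)),
            (⟨!![1, 0; 0, 4], !![1, 0; 0, 4], by decide, by decide⟩ : GL (Fin 2) (ZMod 5))} :
            Set (GL (Fin 2) (ZMod 5)))) := by
  sorry

/-- The in-tree engine of card 2 applies verbatim at `p = 5` (type-check only). -/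
example (G : Subgroup (GL (Fin 2) (ZMod 5)))
    (hirr : ∀ (v : Fin 2 → ZMod 5) (hv : v ≠ 0), ¬ G ≤ eigenvectorStabilizer v hv)
    (hred : ∃ (L : Type) (_ : Field L) (f : ZMod 5 →+* L) (v : Fin 2 → L), v ≠ 0 ∧
      ∀ g ∈ G, Matrix.GeneralLinearGroup.det g = 1 →
        ∃ c : L, ((g : Matrix (Fin 2) (Fin 2) (ZMod 5)).map f) *ᵥ v = c • v) :
    ∃ C ∈ Serre1972.cartanSubgroups (ZMod 5),
      G ≤ Subgroup.normalizer (C : Set (GL (Fin 2) (ZMod 5))) :=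
  CaraianiNewton.exists_le_normalizer_cartan (by decide) G hirr hred

/-! ## Micro-lever shared by both cards: the golden-ratio identity behind
`√5 ∈ K ⇒ χ̄₅(Γ_K) ⊆ {±1}` (PROVED here — the cheapest falsifier of that stub, run in-Lean). -/

/-- `(2(ζ + ζ⁴) + 1)² = 5` for a primitive fifth root of unity `ζ` in any field: the Gauss sum
`ζ − ζ² − ζ³ + ζ⁴` written without characters. [folklore] -/
theorem goldenRatio_sq (L : Type) [Field L] (ζ : L) (hζ : IsPrimitiveRoot ζ 5) :
    (2 * (ζ + ζ ^ 4) + 1) ^ 2 = 5 := by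
  have h5 : ζ ^ 5 = 1 := hζ.pow_eq_one
  have hS : ∑ i ∈ Finset.range 5, ζ ^ i = 0 := hζ.geom_sum_eq_zero (by norm_num)
  simp only [Finset.sum_range_succ, Finset.sum_range_zero, zero_add, pow_zero, pow_one] at hS
  linear_combination 4 * hS + (8 + 4 * ζ ^ 3) * h5

/-- … and a non-square exponent flips its sign: `2(ζ² + ζ³) + 1 = -(2(ζ + ζ⁴) + 1)`, so an
automorphism `ζ ↦ ζ²` or `ζ ↦ ζ³` moves `√5`. [folklore] -/
theorem goldenRatio_conj (L : Type) [Field L] (ζ : L) (hζ : IsPrimitiveRoot ζ 5) :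
    2 * (ζ ^ 2 + ζ ^ 3) + 1 = -(2 * (ζ + ζ ^ 4) + 1) := by
  have hS : ∑ i ∈ Finset.range 5, ζ ^ i = 0 := hζ.geom_sum_eq_zero (by norm_num)
  simp only [Finset.sum_range_succ, Finset.sum_range_zero, zero_add, pow_zero, pow_one] at hS
  linear_combination 2 * hS

#check @exists_eigenvector_of_det_eq_one_of_not_isAbsolutelyIrreducible_restrictField
#check @exists_mul_self_eq_one_and_det_eq_neg_one_of_det_eq
#check @CaraianiNewton.mul_comm_of_det_eq_one
#check @CaraianiNewton.exists_det_eq_one_ne_smul_one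
#check @CaraianiNewton.le_normalizer_unitGroup_adjoinElem_of_det_eq_one
#check @Serre1972.exists_conj_eq_of_trace_eq_det_eq
#check @Serre1972.conj_eq_or_conj_eq_of_mem_normalizer
#check @Serre1972.sq_eq_smul_one_of_mem_normalizer
#check @Serre1972.mem_normalizer_splitCartan_iff
#check @Serre1972.mem_unitGroup_of_conj_eq

end Summit.Langlands.Langlands.Cruxes.ReductionToRefinedLocus.IdeaSketch
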